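import Literature.AlgebraicGeometry.Motives.MixedHodgeStructureSemisimpleMultiplicity
import Literature.AlgebraicGeometry.Motives.MixedHodgeStructureHodgeNumbersAdditive
import HarnessLib

/-!
# Additive functions on mixed Hodge structures are determined by the multiplicities

Sequel to `MixedHodgeStructureCompositionMultiplicity` / `…MultiplicityFormulas` / `…SemisimpleMultiplicity` (the
Jordan–Hölder multiplicity `[H : S] = H.multiplicity S`; `[H : S] = [Gr^W_m H : S]`; MHS with isomorphic graded pieces
have the same multiplicities). Krause, *Homological Theory of Representations*, §13.1 ("Subadditive Functions"):
for an abelian category `𝒞` an **additive function** `χ : 𝒞 → ℕ` satisfies `χ(Y) = χ(X) + χ(Z)` for each exact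
`0 → X → Y → Z → 0`; **Lemma 13.1.1** and its proof, formula **(13.1.2)**: `χ = Σ_{S} χ(S) · χ_S`, where `χ_S(X)` is
"the multiplicity of `S` in a composition series of `X`", "which is unique by the Jordan–Hölder theorem". For the
abelian length category of mixed Hodge structures (Cattani–El Zein–Griffiths–Lê, Thm. 3.2.18) this says that an
additive invariant of MHS is determined by its values on the simple MHS and the multiplicities `[H : S]`; this file
proves the consequences that can be stated without summing over isomorphism classes:

* §1 `IsAdditive χ` for a function `χ` on (finite-dimensional, universe-`u`) MHS with values in an additive
  commutative monoid: invariant under isomorphisms and additive on `0 → R → H → H/R → 0`; then `χ(A ⊕ B) =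
  χ(A) + χ(B)` for complementary sub-MHS and for products, `χ(A ∩ B ⊆ B) = χ(A)` for `A ⊆ B`, `χ(0) = 0`, and the
  weight dévissage **`χ(H) = Σ_k χ(Gr^W_k H)`** (`apply_eq_sum_apply_gr`): an additive invariant of `H` is an
  invariant of its weight-graded pieces.
* §2 examples: the length `λ`, the dimension `dim_ℚ`, the Hodge numbers `h^{p,q}`, the multiplicities `[· : S]`.
* §3 a composition factor `B/A ≅ S` exists whenever `[H : S] > 0` (`exists_subquotientIsoTo_of_multiplicity_pos`).
* §4 **an additive function is determined by its values on simple MHS** (`IsAdditive.ext_of_isSimple`) and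
  **takes the same value on MHS with the same multiplicities** (`IsAdditive.eq_of_forall_multiplicity_eq`,
  Krause (13.1.2); proof by induction on the length, matching a simple sub-MHS of `H` with a composition factor
  of `H'`); hence MHS with the same multiplicities have the same length, dimension and Hodge numbers
  (`length_eq_of_forall_multiplicity_eq`, `finrank_eq_of_forall_multiplicity_eq`,
  `hodgeNumber_eq_of_forall_multiplicity_eq`), and MHS with isomorphic graded pieces have the same additive
  invariants (`IsAdditive.eq_of_forall_gr_iso`).
* §5 **the weights of `H` are the weights of its composition factors**: `k` is a weight of `H` iff some simple
  `S` pure of weight `k` has `[H : S] > 0` (`isWeight_iff_exists_multiplicity_pos`); MHS with the same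
  multiplicities have the same weights.

All statements proved; one definition with body (`IsAdditive`, a `Prop`-valued structure); no named facts,
no instances.

## References

* [Krause2021] H. Krause, Homological Theory of Representations (2021), §13.1, Lemma 13.1.1 and (13.1.2)
  (held text `book:krause2021-homological-theory-representations`, chunk p0413).
* [Beachy1999RingsModules] J. A. Beachy, Introductory Lectures on Rings and Modules (1999), §2.5, Thm. 2.5.2.
* [CattaniElZeinGriffithsLe2014] E. Cattani et al. (eds.), Hodge Theory (2014), Thm. 3.2.18, Cor. 3.2.21 (ii),
  Def. 3.2.15, §3.2.2.6.
-/

noncomputable section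

namespace Literature.AlgebraicGeometry.Motives

namespace MixedHodgeStructure

open Module SubMixedHodgeStructure

universe u v w

section IsoHelpers

variable {W₁ : Type*} [AddCommGroup W₁] [Module ℚ W₁] {G₁ : MixedHodgeStructure W₁}
variable {W₂ : Type*} [AddCommGroup W₂] [Module ℚ W₂] {G₂ : MixedHodgeStructure W₂}

/-- "Isomorphic" is symmetric. [cite: CattaniElZeinGriffithsLe2014, Thm. 3.2.18] -/
private theorem iso_symm (h : ∃ e : Hom G₁ G₂, Function.Bijective e.toLinearMap) :
    ∃ e : Hom G₂ G₁, Function.Bijective e.toLinearMap := by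
  obtain ⟨e, he⟩ := h
  refine ⟨e.inverse he, ?_⟩
  rw [Hom.inverse_toLinearMap]
  exact (LinearEquiv.ofBijective e.toLinearMap he).symm.bijective

end IsoHelpers

/-! ### §1 Additive functions -/

/-- **An additive function on mixed Hodge structures** (Krause, §13.1) with values in an additive commutative
monoid `M`: a function `χ` of finite-dimensional MHS (on `ℚ`-spaces in `Type u`) that is invariant under
isomorphisms and satisfies `χ(H) = χ(R) + χ(H/R)` for every sub-MHS `R ⊆ H`, i.e. `χ(Y) = χ(X) + χ(Z)` for every
short exact sequence `0 → X → Y → Z → 0` of MHS. [cite: Krause2021, §13.1 (additive functions)]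
[cite: CattaniElZeinGriffithsLe2014, Thm. 3.2.18] -/
structure IsAdditive {M : Type v} [AddCommMonoid M]
    (χ : ∀ (U : Type u) [AddCommGroup U] [Module ℚ U] [FiniteDimensional ℚ U], MixedHodgeStructure U → M) : Prop where
  /-- invariance under isomorphisms of MHS -/
  iso : ∀ {U : Type u} [AddCommGroup U] [Module ℚ U] [FiniteDimensional ℚ U] {U' : Type u} [AddCommGroup U']
    [Module ℚ U'] [FiniteDimensional ℚ U'] {G : MixedHodgeStructure U} {G' : MixedHodgeStructure U'} (e : Hom G G'),
    Function.Bijective e.toLinearMap → χ U G = χ U' G'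
  /-- additivity on `0 → R → G → G/R → 0` -/
  add : ∀ {U : Type u} [AddCommGroup U] [Module ℚ U] [FiniteDimensional ℚ U] (G : MixedHodgeStructure U)
    (R : SubMixedHodgeStructure G), χ U G = χ _ R.toMixedHodgeStructure + χ _ R.quotient

variable {M : Type v} [AddCommMonoid M]
variable {χ : ∀ (U : Type u) [AddCommGroup U] [Module ℚ U] [FiniteDimensional ℚ U], MixedHodgeStructure U → M}
variable {V : Type u} [AddCommGroup V] [Module ℚ V] {H : MixedHodgeStructure V}
variable {V' : Type u} [AddCommGroup V'] [Module ℚ V'] {H' : MixedHodgeStructure V'}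
variable {U₀ : Type w} [AddCommGroup U₀] [Module ℚ U₀] {S : MixedHodgeStructure U₀}

namespace IsAdditive

/-- `χ(H) = χ(A) + χ(B)` for complementary sub-MHS `H = A ⊕ B` (`B ≅ H/A`). [cite: Krause2021, §13.1 (SF1)]
[cite: CattaniElZeinGriffithsLe2014, Thm. 3.2.18] -/
theorem eq_add_of_isCompl [FiniteDimensional ℚ V] (hχ : IsAdditive χ) (A B : SubMixedHodgeStructure H)
    (h : IsCompl A.toSubmodule B.toSubmodule) :
    χ V H = χ _ A.toMixedHodgeStructure + χ _ B.toMixedHodgeStructure := by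
  rw [hχ.add H A, ← hχ.iso _ (A.bijective_mkQ_comp_subtype B h)]

/-- `χ(A ⊕ B) = χ(A) + χ(B)` for the product MHS. [cite: Krause2021, §13.1 (SF1)] [cite: CattaniElZeinGriffithsLe2014, Thm. 3.2.18] -/
theorem prod [FiniteDimensional ℚ V] [FiniteDimensional ℚ V'] (hχ : IsAdditive χ) (A : MixedHodgeStructure V)
    (B : MixedHodgeStructure V') : χ _ (A.prod B) = χ V A + χ V' B := by
  rw [hχ.eq_add_of_isCompl _ _ (isCompl_range_inl_range_inr A B),
    ← hχ.iso _ ((Hom.inl A B).rangeRestrict_bijective_of_injective Hom.inl_injective),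
    ← hχ.iso _ ((Hom.inr A B).rangeRestrict_bijective_of_injective LinearMap.inr_injective)]

/-- `χ(A ∩ B ⊆ B) = χ(A)` for sub-MHS `A ⊆ B` (the sub-MHS `A` of `B` is isomorphic to `A`).
[cite: CattaniElZeinGriffithsLe2014, Lemma 3.2.20] -/
theorem apply_comap_subtype [FiniteDimensional ℚ V] (hχ : IsAdditive χ) {A B : SubMixedHodgeStructure H}
    (h : A.toSubmodule ≤ B.toSubmodule) :
    χ _ (A.comap B.subtype).toMixedHodgeStructure = χ _ A.toMixedHodgeStructure := by
  have e : B.ofSub (A.comap B.subtype) = A :=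
    SubMixedHodgeStructure.ext (show (A.toSubmodule.comap B.toSubmodule.subtype).map B.toSubmodule.subtype = A.toSubmodule by
      rw [Submodule.map_comap_subtype, inf_eq_right.2 h])
  obtain ⟨f, hf⟩ := B.exists_hom_ofSub_bijective (A.comap B.subtype)
  rw [hχ.iso f hf, e]

/-- `χ(B) = χ(A) + χ(B/A)` for sub-MHS `A ⊆ B` of `H`. [cite: Krause2021, §13.1 (additive functions)]
[cite: CattaniElZeinGriffithsLe2014, Thm. 3.2.18] -/
theorem apply_eq_add_subquotient [FiniteDimensional ℚ V] (hχ : IsAdditive χ) {A B : SubMixedHodgeStructure H}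
    (h : A.toSubmodule ≤ B.toSubmodule) :
    χ _ B.toMixedHodgeStructure = χ _ A.toMixedHodgeStructure + χ _ (A.comap B.subtype).quotient := by
  rw [hχ.add _ (A.comap B.subtype), hχ.apply_comap_subtype h]

/-- `χ(H) = χ(A) + χ(B/A) + χ(H/B)` for a two-step flag `A ⊆ B ⊆ H`. [cite: Krause2021, §13.1 (additive functions)] -/
theorem apply_eq_add_add [FiniteDimensional ℚ V] (hχ : IsAdditive χ) {A B : SubMixedHodgeStructure H}
    (h : A.toSubmodule ≤ B.toSubmodule) :
    χ V H = χ _ A.toMixedHodgeStructure + χ _ (A.comap B.subtype).quotient + χ _ B.quotient := by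
  rw [hχ.add H B, hχ.apply_eq_add_subquotient h]

/-- An additive function with values in a cancellative monoid vanishes on the zero MHS.
[cite: Krause2021, §13.1 (additive functions)] -/
theorem apply_of_subsingleton {M : Type v} [AddCancelCommMonoid M]
    {χ : ∀ (U : Type u) [AddCommGroup U] [Module ℚ U] [FiniteDimensional ℚ U], MixedHodgeStructure U → M}
    [FiniteDimensional ℚ V] [Subsingleton V] (hχ : IsAdditive χ) (H : MixedHodgeStructure V) : χ V H = 0 := by
  have h := hχ.add H (top H)
  have e₁ : χ _ (top H).toMixedHodgeStructure = χ V H :=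
    hχ.iso (top H).subtype ⟨Submodule.injective_subtype _, fun x => ⟨⟨x, trivial⟩, rfl⟩⟩
  have e₂ : χ _ (top H).quotient = χ V H :=
    (hχ.iso (top H).mkQ ⟨fun x y _ => Subsingleton.elim x y, Submodule.mkQ_surjective _⟩).symm
  rw [e₁, e₂] at h
  exact (add_eq_left.1 h.symm)

/-- Two isomorphic-to-zero MHS have the same value. [cite: Krause2021, §13.1 (additive functions)] -/
theorem apply_eq_of_subsingleton [FiniteDimensional ℚ V] [FiniteDimensional ℚ V'] [Subsingleton V] [Subsingleton V']
    (hχ : IsAdditive χ) (H : MixedHodgeStructure V) (H' : MixedHodgeStructure V') : χ V H = χ V' H' :=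
  hχ.iso (Hom.zero H H') ⟨Function.injective_of_subsingleton _, fun _ => ⟨0, Subsingleton.elim _ _⟩⟩

/-- One step of the weight filtration: **`χ(W_k H) = χ(W_{k-1} H) + χ(Gr^W_k H)`** (`Gr^W_k H = W_k H ∕ W_{k-1} H`).
[cite: Krause2021, §13.1 (additive functions)] [cite: CattaniElZeinGriffithsLe2014, Def. 3.2.15] -/
theorem apply_weight_eq_add_apply_gr [FiniteDimensional ℚ V] (hχ : IsAdditive χ) (H : MixedHodgeStructure V) (k : ℤ) :
    χ _ (weight H k).toMixedHodgeStructure =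
      χ _ (weight H (k - 1)).toMixedHodgeStructure + χ _ (H.gr k).toMixedHodgeStructure := by
  rw [gr_toMixedHodgeStructure_eq_quotient,
    ← hχ.apply_comap_subtype (A := weight H (k - 1)) (B := weight H k) (H.monotone_W (by omega))]
  exact hχ.add _ (weightPred H k)

/-- Telescoping: `χ(W_{a+n} H) = χ(W_a H) + Σ_{k ∈ (a, a+n]} χ(Gr^W_k H)`. [cite: Krause2021, §13.1 (additive functions)]
[cite: CattaniElZeinGriffithsLe2014, Def. 3.2.15] -/
theorem apply_weight_add_eq [FiniteDimensional ℚ V] (hχ : IsAdditive χ) (H : MixedHodgeStructure V) (a : ℤ) (n : ℕ) :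
    χ _ (weight H (a + n)).toMixedHodgeStructure =
      χ _ (weight H a).toMixedHodgeStructure + ∑ k ∈ Finset.Ioc a (a + n), χ _ (H.gr k).toMixedHodgeStructure := by
  induction n with
  | zero => rw [Nat.cast_zero, add_zero, Finset.Ioc_self, Finset.sum_empty, add_zero]
  | succ n ih =>
    have hstep := hχ.apply_weight_eq_add_apply_gr H (a + (n + 1 : ℕ))
    rw [show a + ((n + 1 : ℕ) : ℤ) - 1 = a + n by push_cast; ring] at hstep
    rw [hstep, ih, add_assoc, show a + ((n + 1 : ℕ) : ℤ) = a + n + 1 by push_cast; ring,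
      ← Finset.insert_Ioc_right_eq_Ioc_add_one (show a ≤ a + n by omega), Finset.sum_insert (by simp), add_comm
        (χ _ (H.gr (a + n + 1)).toMixedHodgeStructure)]

/-- **`χ(H) = Σ_{a < k ≤ b} χ(Gr^W_k H)` whenever `W_a H = 0` and `W_b H = V`** (values in a cancellative monoid):
an additive invariant of `H` only depends on the graded pieces `Gr^W_k H` — the class of `H` is the class of its
weight-graded object. [cite: Krause2021, §13.1, (13.1.2)] [cite: CattaniElZeinGriffithsLe2014, Def. 3.2.15 and Thm. 3.2.18] -/
theorem apply_eq_sum_apply_gr {M : Type v} [AddCancelCommMonoid M]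
    {χ : ∀ (U : Type u) [AddCommGroup U] [Module ℚ U] [FiniteDimensional ℚ U], MixedHodgeStructure U → M}
    [FiniteDimensional ℚ V] (hχ : IsAdditive χ) (H : MixedHodgeStructure V) {a b : ℤ} (ha : H.W a = ⊥) (hb : H.W b = ⊤) :
    χ V H = ∑ k ∈ Finset.Ioc a b, χ _ (H.gr k).toMixedHodgeStructure := by
  have hbot : χ _ (weight H a).toMixedHodgeStructure = 0 := by
    haveI : Subsingleton (weight H a).toSubmodule := by rw [weight_toSubmodule, ha]; infer_instance
    exact hχ.apply_of_subsingleton _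
  have htop : χ _ (weight H b).toMixedHodgeStructure = χ V H := by
    have hsub : Function.Bijective (weight H b).subtype.toLinearMap := by
      refine ⟨Submodule.injective_subtype _, ?_⟩
      rw [← LinearMap.range_eq_top]
      exact (Submodule.range_subtype _).trans hb
    exact hχ.iso _ hsub
  rcases le_or_gt a b with hab | hab
  · obtain ⟨n, rfl⟩ := Int.le.dest hab
    rw [← htop, hχ.apply_weight_add_eq, hbot, zero_add]
  · have hV : (⊤ : Submodule ℚ V) = ⊥ := by
      rw [← hb, eq_bot_iff, ← ha]
      exact H.monotone_W hab.le
    haveI : Subsingleton V := subsingleton_of_forall_eq 0 fun v => (Submodule.mem_bot ℚ).1 (hV ▸ Submodule.mem_top)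
    rw [Finset.Ioc_eq_empty (not_lt.2 hab.le), Finset.sum_empty]
    exact hχ.apply_of_subsingleton H

end IsAdditive

/-! ### §2 Examples: length, dimension, Hodge numbers, multiplicities -/

/-- **The length `λ` is additive.** [cite: Krause2021, §13.1 (additive functions)] [cite: Beachy1999RingsModules, §2.5, Thm. 2.5.2] -/
theorem isAdditive_length :
    IsAdditive (fun (U : Type u) _ _ _ (G : MixedHodgeStructure U) => G.length) :=
  ⟨fun e he => length_eq_of_bijective e he, fun _ R => R.length_add_length_quotient.symm⟩

/-- **The dimension `dim_ℚ` is additive.** [cite: Krause2021, §13.1 (additive functions)] -/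
theorem isAdditive_finrank :
    IsAdditive (fun (U : Type u) _ _ _ (_ : MixedHodgeStructure U) => finrank ℚ U) :=
  ⟨fun e he => (LinearEquiv.ofBijective e.toLinearMap he).finrank_eq,
    fun _ R => by rw [add_comm]; exact (R.toSubmodule.finrank_quotient_add_finrank).symm⟩

/-- **The Hodge numbers `h^{p,q}` are additive** (exactness of `Gr^W Gr_F`, Cattani et al., Cor. 3.2.21 (ii)).
[cite: CattaniElZeinGriffithsLe2014, Cor. 3.2.21 (ii)] [cite: Krause2021, §13.1 (additive functions)] -/
theorem isAdditive_hodgeNumber (p q : ℤ) :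
    IsAdditive (fun (U : Type u) _ _ _ (G : MixedHodgeStructure U) => G.hodgeNumber p q) :=
  ⟨fun e he => Hom.hodgeNumber_eq_of_bijective e he p q, fun _ R => R.hodgeNumber_eq_add p q⟩

/-- **The multiplicity `[· : S]` is additive** — the irreducible additive function `χ_S` of Krause (13.1.2).
[cite: Krause2021, §13.1, (13.1.2)] [cite: Beachy1999RingsModules, §2.5, Thm. 2.5.2] -/
theorem isAdditive_multiplicity (S : MixedHodgeStructure U₀) :
    IsAdditive (fun (U : Type u) _ _ _ (G : MixedHodgeStructure U) => G.multiplicity S) :=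
  ⟨fun e he => multiplicity_eq_of_bijective e he S, fun _ R => (R.multiplicity_add S).symm⟩

/-! ### §3 Composition factors of positive multiplicity -/

/-- **If `[H : S] > 0` then `S ≅ B/A` for some sub-MHS `A ⊆ B ⊆ H`** (a composition factor of a Jordan–Hölder
series). [cite: Beachy1999RingsModules, §2.5, Def. 2.5.1 and Thm. 2.5.2] [cite: CattaniElZeinGriffithsLe2014, Thm. 3.2.18] -/
theorem exists_subquotientIsoTo_of_multiplicity_pos [FiniteDimensional ℚ V] (h : 0 < H.multiplicity S) :
    ∃ A B : SubMixedHodgeStructure H, A.toSubmodule ≤ B.toSubmodule ∧ SubquotientIsoTo A B S := by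
  classical
  obtain ⟨t, h₁, h₂⟩ := exists_compositionSeries H
  rw [← t.count_eq_multiplicity h₁ h₂, CompositionSeries.count_eq] at h
  obtain ⟨i, -, hi⟩ := Finset.exists_ne_zero_of_sum_ne_zero h.ne'
  have hi' : SubquotientIsoTo (ofElt (t i.castSucc)) (ofElt (t i.succ)) S := by
    by_contra hc
    exact hi (if_neg hc)
  exact ⟨_, _, (t.covBy_succ i).le, hi'⟩

/-! ### §4 Additive functions are determined by the multiplicities -/

namespace IsAdditive

/-- The auxiliary induction on the length for `IsAdditive.eq_of_forall_multiplicity_eq`.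
[cite: Krause2021, §13.1, Lemma 13.1.1 (proof) and (13.1.2)] -/
private theorem eq_aux (hχ : IsAdditive χ) (n : ℕ) : ∀ {W : Type u} [AddCommGroup W] [Module ℚ W] [FiniteDimensional ℚ W]
    (K : MixedHodgeStructure W) {W' : Type u} [AddCommGroup W'] [Module ℚ W'] [FiniteDimensional ℚ W']
    (K' : MixedHodgeStructure W'), K.length ≤ n →
    (∀ (U : Type u) [AddCommGroup U] [Module ℚ U] (S : MixedHodgeStructure U), S.IsSimple →
      K.multiplicity S = K'.multiplicity S) → χ W K = χ W' K' := by
  induction n with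
  | zero =>
    intro W _ _ _ K W' _ _ _ K' hn h
    haveI : Subsingleton W := length_eq_zero_iff.1 (Nat.le_zero.1 hn)
    haveI : Subsingleton W' := by
      by_contra hW'
      rw [not_subsingleton_iff_nontrivial] at hW'
      obtain ⟨S', hS'⟩ := K'.exists_subMixedHodgeStructure_isSimple
      have h1 := S'.one_le_multiplicity_of_isSimple hS'
      rw [← h _ S'.toMixedHodgeStructure hS', multiplicity_eq_zero_of_subsingleton] at h1
      exact Nat.not_succ_le_zero 0 h1
    exact hχ.apply_eq_of_subsingleton K K'
  | succ n ih =>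
    intro W _ _ _ K W' _ _ _ K' hn h
    by_cases hW : Subsingleton W
    · exact ih K K' (by rw [length_eq_zero_iff.2 hW]; exact Nat.zero_le _) h
    rw [not_subsingleton_iff_nontrivial] at hW
    -- a simple sub-MHS `S₀ ⊆ K` occurs as a composition factor `B'/A'` of `K'`
    obtain ⟨S₀, hS₀⟩ := K.exists_subMixedHodgeStructure_isSimple
    have hpos : 0 < K'.multiplicity S₀.toMixedHodgeStructure := by
      rw [← h _ S₀.toMixedHodgeStructure hS₀]
      exact S₀.one_le_multiplicity_of_isSimple hS₀
    obtain ⟨A', B', hle, e, he⟩ := exists_subquotientIsoTo_of_multiplicity_pos hpos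
    -- `K/S₀` and `A' ⊕ K'/B'` have the same multiplicities and smaller length
    have hmul : ∀ (U : Type u) [AddCommGroup U] [Module ℚ U] (S : MixedHodgeStructure U), S.IsSimple →
        S₀.quotient.multiplicity S = (A'.toMixedHodgeStructure.prod B'.quotient).multiplicity S := by
      intro U _ _ S hS
      have h1 := h U S hS
      rw [← S₀.multiplicity_add S, ← B'.multiplicity_add S, ← (A'.comap B'.subtype).multiplicity_add S,
        multiplicity_comap_subtype hle S, multiplicity_eq_of_bijective e he S] at h1
      rw [multiplicity_prod]
      omega
    have hlen : S₀.quotient.length ≤ n := by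
      haveI := hS₀.nontrivial
      have h1 := S₀.length_quotient_lt (Submodule.nontrivial_iff_ne_bot.1 inferInstance)
      omega
    have hIH := ih S₀.quotient (A'.toMixedHodgeStructure.prod B'.quotient) hlen hmul
    -- assemble: `χ K = χ S₀ + χ(K/S₀)`, `χ K' = χ A' + χ(B'/A') + χ(K'/B')`, `χ(B'/A') = χ S₀`
    rw [hχ.add K S₀, hIH, hχ.prod, hχ.apply_eq_add_add hle, hχ.iso e he, add_left_comm, add_assoc]

/-- **Additive functions are determined by the multiplicities** (Krause (13.1.2): `χ = Σ_S χ(S) χ_S`): if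
`[H : S] = [H' : S]` for every simple MHS `S`, then `χ(H) = χ(H')` for every additive function `χ`.
[cite: Krause2021, §13.1, Lemma 13.1.1 and (13.1.2)] [cite: CattaniElZeinGriffithsLe2014, Thm. 3.2.18] -/
theorem eq_of_forall_multiplicity_eq [FiniteDimensional ℚ V] [FiniteDimensional ℚ V'] (hχ : IsAdditive χ)
    (h : ∀ (U : Type u) [AddCommGroup U] [Module ℚ U] (S : MixedHodgeStructure U), S.IsSimple →
      H.multiplicity S = H'.multiplicity S) : χ V H = χ V' H' :=
  eq_aux hχ H.length H H' le_rfl h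

/-- **MHS with isomorphic graded pieces `Gr^W_k H ≅ Gr^W_k H'` (all `k`) have the same additive invariants** (they
have the same multiplicities, `multiplicity_eq_of_forall_gr_iso`). [cite: Krause2021, §13.1, (13.1.2)]
[cite: CattaniElZeinGriffithsLe2014, Def. 3.2.15 and Thm. 3.2.18] -/
theorem eq_of_forall_gr_iso [FiniteDimensional ℚ V] [FiniteDimensional ℚ V'] (hχ : IsAdditive χ)
    (hgr : ∀ k, ∃ e : Hom (H.gr k).toMixedHodgeStructure (H'.gr k).toMixedHodgeStructure, Function.Bijective e.toLinearMap) :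
    χ V H = χ V' H' :=
  hχ.eq_of_forall_multiplicity_eq fun _ _ _ S _ => multiplicity_eq_of_forall_gr_iso hgr S

/-- The auxiliary induction on the length for `IsAdditive.ext_of_isSimple`. [cite: Krause2021, §13.1, Lemma 13.1.1 (proof)] -/
private theorem ext_aux {χ' : ∀ (U : Type u) [AddCommGroup U] [Module ℚ U] [FiniteDimensional ℚ U], MixedHodgeStructure U → M}
    (hχ : IsAdditive χ) (hχ' : IsAdditive χ')
    (h : ∀ (U : Type u) [AddCommGroup U] [Module ℚ U] [FiniteDimensional ℚ U] (S : MixedHodgeStructure U),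
      S.IsSimple → χ U S = χ' U S)
    (h0 : ∀ (U : Type u) [AddCommGroup U] [Module ℚ U] [FiniteDimensional ℚ U] [Subsingleton U]
      (G : MixedHodgeStructure U), χ U G = χ' U G) (n : ℕ) :
    ∀ {W : Type u} [AddCommGroup W] [Module ℚ W] [FiniteDimensional ℚ W] (K : MixedHodgeStructure W),
      K.length ≤ n → χ W K = χ' W K := by
  induction n with
  | zero =>
    intro W _ _ _ K hn
    haveI : Subsingleton W := length_eq_zero_iff.1 (Nat.le_zero.1 hn)
    exact h0 W K
  | succ n ih =>
    intro W _ _ _ K hn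
    by_cases hW : Subsingleton W
    · exact h0 W K
    rw [not_subsingleton_iff_nontrivial] at hW
    obtain ⟨S₀, hS₀⟩ := K.exists_subMixedHodgeStructure_isSimple
    have hlen : S₀.quotient.length ≤ n := by
      haveI := hS₀.nontrivial
      have h1 := S₀.length_quotient_lt (Submodule.nontrivial_iff_ne_bot.1 inferInstance)
      omega
    rw [hχ.add K S₀, hχ'.add K S₀, h _ _ hS₀, ih S₀.quotient hlen]

/-- **An additive function is determined by its values on the simple MHS (and on `0`)**: two additive functions
agreeing on all simple MHS and on the zero MHS agree everywhere (uniqueness in Krause (13.1.2)).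
[cite: Krause2021, §13.1, Lemma 13.1.1 and (13.1.2)] -/
theorem ext_of_isSimple [FiniteDimensional ℚ V]
    {χ' : ∀ (U : Type u) [AddCommGroup U] [Module ℚ U] [FiniteDimensional ℚ U], MixedHodgeStructure U → M}
    (hχ : IsAdditive χ) (hχ' : IsAdditive χ')
    (h : ∀ (U : Type u) [AddCommGroup U] [Module ℚ U] [FiniteDimensional ℚ U] (S : MixedHodgeStructure U),
      S.IsSimple → χ U S = χ' U S)
    (h0 : ∀ (U : Type u) [AddCommGroup U] [Module ℚ U] [FiniteDimensional ℚ U] [Subsingleton U]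
      (G : MixedHodgeStructure U), χ U G = χ' U G) (H : MixedHodgeStructure V) : χ V H = χ' V H :=
  ext_aux hχ hχ' h h0 H.length H le_rfl

/-- The same for additive functions with values in a cancellative monoid (both vanish on `0` automatically).
[cite: Krause2021, §13.1, Lemma 13.1.1 and (13.1.2)] -/
theorem ext_of_isSimple' {M : Type v} [AddCancelCommMonoid M] [FiniteDimensional ℚ V]
    {χ χ' : ∀ (U : Type u) [AddCommGroup U] [Module ℚ U] [FiniteDimensional ℚ U], MixedHodgeStructure U → M}
    (hχ : IsAdditive χ) (hχ' : IsAdditive χ')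
    (h : ∀ (U : Type u) [AddCommGroup U] [Module ℚ U] [FiniteDimensional ℚ U] (S : MixedHodgeStructure U),
      S.IsSimple → χ U S = χ' U S) (H : MixedHodgeStructure V) : χ V H = χ' V H :=
  hχ.ext_of_isSimple hχ' h (fun U _ _ _ _ G => by rw [hχ.apply_of_subsingleton G, hχ'.apply_of_subsingleton G]) H

end IsAdditive

/-- **MHS with the same multiplicities have the same length.** [cite: Krause2021, §13.1, (13.1.2)]
[cite: Beachy1999RingsModules, §2.5, Thm. 2.5.2] -/
theorem length_eq_of_forall_multiplicity_eq [FiniteDimensional ℚ V] [FiniteDimensional ℚ V']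
    (h : ∀ (U : Type u) [AddCommGroup U] [Module ℚ U] (S : MixedHodgeStructure U), S.IsSimple →
      H.multiplicity S = H'.multiplicity S) : H.length = H'.length :=
  isAdditive_length.eq_of_forall_multiplicity_eq h

/-- **MHS with the same multiplicities have the same dimension.** [cite: Krause2021, §13.1, (13.1.2)] -/
theorem finrank_eq_of_forall_multiplicity_eq [FiniteDimensional ℚ V] [FiniteDimensional ℚ V']
    (h : ∀ (U : Type u) [AddCommGroup U] [Module ℚ U] (S : MixedHodgeStructure U), S.IsSimple →
      H.multiplicity S = H'.multiplicity S) : finrank ℚ V = finrank ℚ V' :=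
  isAdditive_finrank.eq_of_forall_multiplicity_eq (H := H) (H' := H') h

/-- **MHS with the same multiplicities have the same Hodge numbers.** [cite: Krause2021, §13.1, (13.1.2)]
[cite: CattaniElZeinGriffithsLe2014, Cor. 3.2.21 (ii) and §3.2.2.6] -/
theorem hodgeNumber_eq_of_forall_multiplicity_eq [FiniteDimensional ℚ V] [FiniteDimensional ℚ V']
    (h : ∀ (U : Type u) [AddCommGroup U] [Module ℚ U] (S : MixedHodgeStructure U), S.IsSimple →
      H.multiplicity S = H'.multiplicity S) (p q : ℤ) : H.hodgeNumber p q = H'.hodgeNumber p q :=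
  (isAdditive_hodgeNumber p q).eq_of_forall_multiplicity_eq h

/-- Multiplicities agreeing on simple MHS agree on all MHS (`[· : S]` vanishes for non-simple `S`).
[cite: Beachy1999RingsModules, §2.5, Def. 2.5.1] -/
theorem multiplicity_eq_of_forall_multiplicity_eq [FiniteDimensional ℚ V] [FiniteDimensional ℚ V']
    (h : ∀ (U : Type u) [AddCommGroup U] [Module ℚ U] (S : MixedHodgeStructure U), S.IsSimple →
      H.multiplicity S = H'.multiplicity S) (S : MixedHodgeStructure U₀) : H.multiplicity S = H'.multiplicity S := by
  by_cases hS : S.IsSimple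
  · -- transport `S` to a composition factor in universe `u` when it occurs, else both vanish
    by_cases hpos : 0 < H.multiplicity S
    · obtain ⟨A, B, -, e, he⟩ := exists_subquotientIsoTo_of_multiplicity_pos hpos
      rw [← multiplicity_congr H e he, ← multiplicity_congr H' e he]
      exact h _ _ ((isSimple_iff_of_bijective e he).2 hS)
    · by_cases hpos' : 0 < H'.multiplicity S
      · obtain ⟨A, B, -, e, he⟩ := exists_subquotientIsoTo_of_multiplicity_pos hpos'
        rw [← multiplicity_congr H e he, ← multiplicity_congr H' e he]
        exact h _ _ ((isSimple_iff_of_bijective e he).2 hS)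
      · omega
  · rw [multiplicity_eq_zero_of_not_isSimple H hS, multiplicity_eq_zero_of_not_isSimple H' hS]

/-! ### §5 The weights of `H` are the weights of its composition factors -/

/-- **`k` is a weight of `H` iff some simple `S`, pure of weight `k`, has `[H : S] > 0`.**
[cite: CattaniElZeinGriffithsLe2014, Def. 3.2.15 and Ex. 3.2.23 (1)] [cite: Beachy1999RingsModules, §2.5, Thm. 2.5.2] -/
theorem isWeight_iff_exists_multiplicity_pos [FiniteDimensional ℚ V] (H : MixedHodgeStructure V) (k : ℤ) :
    H.IsWeight k ↔ ∃ (U : Type u) (_ : AddCommGroup U) (_ : Module ℚ U) (S : MixedHodgeStructure U),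
      S.IsSimple ∧ S.IsPure k ∧ 0 < H.multiplicity S := by
  constructor
  · intro hk
    haveI : Nontrivial (grW H.W k) := by
      rw [← not_subsingleton_iff_nontrivial]
      intro hc
      have htop : subPiece H.W k = ⊤ := Submodule.Quotient.subsingleton_iff.1 hc
      have hge : H.W k ≤ H.W (k - 1) := fun x hx => by
        have hx' : (⟨x, hx⟩ : H.W k) ∈ subPiece H.W k := htop ▸ Submodule.mem_top
        exact hx'
      exact lt_irrefl _ ((show H.W (k - 1) < H.W k from hk).trans_le hge)
    obtain ⟨T, hT⟩ := (H.gr k).toMixedHodgeStructure.exists_subMixedHodgeStructure_isSimple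
    have hTp : T.toMixedHodgeStructure.IsPure k :=
      (HodgeStructure.isPure_toMixedHodgeStructure (H.gr k)).subMixedHodgeStructure T
    haveI := hT.nontrivial
    refine ⟨_, inferInstance, inferInstance, T.toMixedHodgeStructure, hT, hTp, ?_⟩
    rw [multiplicity_eq_multiplicity_gr H hTp]
    exact T.one_le_multiplicity_of_isSimple hT
  · rintro ⟨U, _, _, S, hS, hSp, hpos⟩
    haveI := hS.nontrivial
    exact isWeight_of_multiplicity_pos hSp hpos

/-- **MHS with the same multiplicities have the same weights.** [cite: CattaniElZeinGriffithsLe2014, Def. 3.2.15 and Ex. 3.2.23 (1)]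
[cite: Krause2021, §13.1, (13.1.2)] -/
theorem isWeight_iff_of_forall_multiplicity_eq [FiniteDimensional ℚ V] [FiniteDimensional ℚ V']
    (h : ∀ (U : Type u) [AddCommGroup U] [Module ℚ U] (S : MixedHodgeStructure U), S.IsSimple →
      H.multiplicity S = H'.multiplicity S) (k : ℤ) : H.IsWeight k ↔ H'.IsWeight k := by
  rw [isWeight_iff_exists_multiplicity_pos H k, isWeight_iff_exists_multiplicity_pos H' k]
  refine exists_congr fun U => exists_congr fun _ => exists_congr fun _ => exists_congr fun S => ?_
  exact and_congr_right fun hS => and_congr_right fun _ => by rw [h U S hS]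

/-- **MHS with the same multiplicities have the same graded-piece multiplicities `[Gr^W_k H : S]`** (hence the
same `λ(Gr^W_k)`, …). [cite: CattaniElZeinGriffithsLe2014, Def. 3.2.15 and Ex. 3.2.23 (1)] [cite: Krause2021, §13.1, (13.1.2)] -/
theorem multiplicity_gr_eq_of_forall_multiplicity_eq [FiniteDimensional ℚ V] [FiniteDimensional ℚ V']
    (h : ∀ (U : Type u) [AddCommGroup U] [Module ℚ U] (S : MixedHodgeStructure U), S.IsSimple →
      H.multiplicity S = H'.multiplicity S) (k : ℤ) (S : MixedHodgeStructure U₀) :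
    (H.gr k).toMixedHodgeStructure.multiplicity S = (H'.gr k).toMixedHodgeStructure.multiplicity S := by
  by_cases hS : S.IsSimple
  · haveI := hS.nontrivial
    obtain ⟨m, hm⟩ := hS.exists_isPure
    by_cases hkm : k = m
    · subst hkm
      rw [← multiplicity_eq_multiplicity_gr H hm, ← multiplicity_eq_multiplicity_gr H' hm]
      exact multiplicity_eq_of_forall_multiplicity_eq h S
    · rw [multiplicity_gr_eq_zero_of_ne H hm hkm, multiplicity_gr_eq_zero_of_ne H' hm hkm]
  · rw [multiplicity_eq_zero_of_not_isSimple _ hS, multiplicity_eq_zero_of_not_isSimple _ hS]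

/-- Hence **MHS with the same multiplicities have graded pieces of the same length `λ(Gr^W_k)`** and of the same
Hodge numbers. [cite: Krause2021, §13.1, (13.1.2)] [cite: CattaniElZeinGriffithsLe2014, Def. 3.2.15] -/
theorem length_gr_eq_of_forall_multiplicity_eq [FiniteDimensional ℚ V] [FiniteDimensional ℚ V']
    (h : ∀ (U : Type u) [AddCommGroup U] [Module ℚ U] (S : MixedHodgeStructure U), S.IsSimple →
      H.multiplicity S = H'.multiplicity S) (k : ℤ) :
    (H.gr k).toMixedHodgeStructure.length = (H'.gr k).toMixedHodgeStructure.length :=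
  length_eq_of_forall_multiplicity_eq fun _ _ _ S _ => multiplicity_gr_eq_of_forall_multiplicity_eq h k S

end MixedHodgeStructure

end Literature.AlgebraicGeometry.Motives
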